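import Summits.CriticalPhenomena.PercolationContinuityZ3.Theorems.Transplant.BccSlabTwoHub
import Summits.CriticalPhenomena.PercolationContinuityZ3.Theorems.Transplant.BccSlabTwoCert
import Summits.CriticalPhenomena.PercolationContinuityZ3.Theorems.Transplant.BccClawX2Legs
import Summits.CriticalPhenomena.PercolationContinuityZ3.Theorems.Transplant.BccSlabStackedRoute
import HarnessLib

/-!
# The bcc (001)-slabs, exit-form routing certificate for THICKNESS `k = 2`, VI: **`θ_{S_2(bcc)}(p_c) = 0`**, and the bcc (001)-slab row COMPLETE —
# `θ_{S_k(bcc)}(v, p_c(S_k(bcc))) = 0` for EVERY thickness `k ≥ 1` and every vertex, unconditionally, without p205010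

builds on p205010 (kernel theorem, internal audit signed; external expert review pending) — NOT used in this file (nor anywhere in this row).
Lane `prim-bschramm`, seat `prim-bschramm-p2` (gen 47; class C1b = films / other 3D lattices at their own critical point, METHOD = input
substitution; memo `HOME/bschramm/P2-LATTICES.md` §157); helper file (`--supports stmt-CriticalPhenomena-4575 --as helper`).

THE ROW.  `S_k(bcc) = bcc ∩ {0 ≤ x₂ ≤ k}` («BccSlabCritical».`slabGraph k`) at its own critical point: `k = 1` is `ℤ²` drawn along the diagonals
(«BccSlabSqShadowCritical».`theta_criticalProb_eq_zero_one`, injective square shadow), `k ≥ 3` is «BccSlabStackedRoute».`theta_criticalProb_eq_zero` (hub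
template + stacked templates), and `k = 2` — the slab whose even columns carry the twins `(a,0)`, `(a,2)` and whose odd columns carry one vertex — is this
file: the column-level routing with the twin side conditions («BccSlabTwoCert».`ColRoutingTwin 2`) holds by the parity-aware planar claw oracle
(«BccClawX2Table*», kernel; «BccClawX2Legs».`exists_claw2_of_tgtCols`) and the even-hub template («BccSlabTwoHub».`swapPair_of_clawProps_even`).
* §1 **`BccSlab.colRoutingTwin_two`**, **`BccSlab.theta_criticalProb_eq_zero_two`**: `θ_{S_2(bcc)}(v, p_c(S_2(bcc))) = 0` for every vertex;
* §2 **`BccSlab.theta_criticalProb_eq_zero_of_one_le`**: `θ_{S_k(bcc)}(v, p_c(S_k(bcc))) = 0` for every `k ≥ 1` and every vertex — the Benjamini–Schramm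
  continuity conjecture for the whole family of bcc (001)-slabs, by the Duminil-Copin–Sidoravicius–Tassion transplant «SqShadow*», p205010-free.
(`k = 0` is the edgeless even sublattice of the plane `x₂ = 0`: no bond of bcc stays in one layer.)
[cite: DuminilCopinSidoraviciusTassion2016, Thm. 1 and §2.3 (proof of Fact 2)] [cite: BenjaminiSchramm1996, Conj. 4 / Question 3] [cite: ConwaySloane1999, Ch. 4 §7.1]
-/

noncomputable section

namespace Summit.CriticalPhenomena.PercolationContinuityZ3.Theorems.Transplant

namespace BccSlab

open Literature.Probability.Percolation Literature.Probability.LatticeModels SimpleGraph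
open BccClawX
open scoped Classical

variable {k : ℕ}

/-! ## §1 Thickness two -/

/-- **COLUMN-LEVEL ROUTING WITH THE TWIN SIDE CONDITIONS HOLDS FOR `S_2(bcc)`**: a column-certified triple (stacked terminals carrying their side
conditions, and then an even column by «BccSlabTwoCert».`even_of_twins`) has an even-hub planar claw by the kernel table, and the even-hub template turns
it into a swap pair. [cite: DuminilCopinSidoraviciusTassion2016, §2.3 (proof of Fact 2: the three disjoint paths in B̄_R(z))] -/
theorem colRoutingTwin_two : ColRoutingTwin 2 := by
  intro z tR tD sR sD hRD hSE hone E₁ E₂ w' hne h1 h1R h1z h2 h2R h2z h3 h31 h32 htw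
  have hts : 3 ≤ tD ∨ 3 ≤ sD := hone.imp (fun h => h.trans hRD) (fun h => h.trans hSE)
  have h3z : sh w' ≠ z := fun h => centre_not_mem_tgtCols hts (h ▸ h3)
  have htwin : sh E₁ = sh E₂ → Even (sh E₁ 0 + sh E₁ 1) ∧ ¬ (zdGraph 2).Adj (sh E₁) (sh w') ∧
      ∃ O₁ O₂ : Site 2, O₁ ≠ O₂ ∧ (zdGraph 2).Adj (sh E₁) O₁ ∧ (zdGraph 2).Adj (sh E₁) O₂ ∧ O₁ ∈ extCols z tD sD ∧ O₂ ∈ extCols z tD sD :=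
    fun hs => ⟨even_of_twins hne hs, htw hs⟩
  obtain ⟨q, l1, l2, l3, hev, hP⟩ := exists_claw2_of_tgtCols hRD hSE hone h1 h1R h1z h2 h2R h2z h3 h3z h31 h32 htwin
  have hpar : Even (z 0 + z 1 + q.1 + q.2) := by
    simp only [evenb, beq_iff_eq] at hev
    exact ⟨(z 0 + z 1 + q.1 + q.2) / 2, by omega⟩
  exact swapPair_of_clawProps_even (k := 2) le_rfl hne hpar hP

/-- **`θ_{S_2(bcc)}(v, p_c(S_2(bcc))) = 0` FOR EVERY VERTEX — UNCONDITIONAL**, p205010-free (the square DST layer «SqShadow*», the thin-instance routing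
«SqShadowVRoutingX», the cleared set `lift (block ∖ corners)`, the parity-aware claw oracle and the even-hub template).
[cite: DuminilCopinSidoraviciusTassion2016, Thm. 1 and §2.3] [cite: BenjaminiSchramm1996, Conj. 4 / Question 3] -/
theorem theta_criticalProb_eq_zero_two (v : bslab 2) : theta (slabGraph 2) v (criticalProbIOf (slabGraph 2) v) = 0 :=
  theta_criticalProb_eq_zero_two_of_colRoutingTwin colRoutingTwin_two v

/-! ## §2 The whole family -/

/-- **THE bcc (001)-SLAB ROW: `θ_{S_k(bcc)}(v, p_c(S_k(bcc))) = 0` FOR EVERY THICKNESS `k ≥ 1` AND EVERY VERTEX — UNCONDITIONAL**, p205010-free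
(`k = 1`: «BccSlabSqShadowCritical»; `k = 2`: §1; `k ≥ 3`: «BccSlabStackedRoute»).
[cite: DuminilCopinSidoraviciusTassion2016, Thm. 1] [cite: BenjaminiSchramm1996, Conj. 4 / Question 3] [cite: ConwaySloane1999, Ch. 4 §7.1] -/
theorem theta_criticalProb_eq_zero_of_one_le (hk : 1 ≤ k) (v : bslab k) : theta (slabGraph k) v (criticalProbIOf (slabGraph k) v) = 0 := by
  rcases Nat.lt_or_ge k 3 with h | h
  · interval_cases k
    · exact theta_criticalProb_eq_zero_one v
    · exact theta_criticalProb_eq_zero_two v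
  · exact theta_criticalProb_eq_zero h v

/-- The row, quantified form: for all `k ≥ 1` and all vertices of `S_k(bcc)`, `θ(v, p_c) = 0`. [cite: BenjaminiSchramm1996, Conj. 4 / Question 3] -/
theorem theta_criticalProb_eq_zero_family : ∀ k : ℕ, 1 ≤ k → ∀ v : bslab k, theta (slabGraph k) v (criticalProbIOf (slabGraph k) v) = 0 :=
  fun _ hk v => theta_criticalProb_eq_zero_of_one_le hk v

end BccSlab

end Summit.CriticalPhenomena.PercolationContinuityZ3.Theorems.Transplant

end
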